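import Summits.BirchSwinnertonDyer.Rank1Residual.Additive.QuadraticBranchCharacterEvaluation
import Summits.BirchSwinnertonDyer.Rank1Residual.Additive.QuadraticBranchPlusLFunctionUnique
import HarnessLib

/-!
# NON-VANISHING of Kobayashi's quadratic-branch functions: every `L` with
# `IsQuadraticBranchMinusLFunction f p ϖ L` (resp. `IsQuadraticBranchPlusLFunction f p ϖ L`), `ϖ ≠ 0`,
# is `≠ 0` — Rohrlich's theorem through Birch's formula on the characters `ψ = ηχ` of order `2pⁿ`
# (Kobayashi 2003 Thm. 3.2 / Pollack 2003 Cor. 5.11 on the branch `η = ω^{(p−1)/2}`; proofs only; file 7)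

HONEST FRAMING (cell `bsd-potss`, run/shared/lean/pub/bsd-potss/, FULL-BSD rank ≤ 1 programme
tranche 1b, human ruling D-0036; seat `bsd-potss-ctrl` = "signed control along the quadratic branch"):
the programme's target of record is FULL BSD for every analytic-rank ≤ 1 curve over `ℚ`; this seat's
object is the quadratic (`η = ω^{(p−1)/2}`) branch of Kobayashi's signed theory for the good
`a_p = 0` twin `V` of an additive potentially supersingular curve `W = V ⊗ η` (classes Gss2 / O5 `e = 2`,
O10-PS). THIS FILE: THEOREMS ONLY (no definition, no `sorry`); NOTHING about `BSD(W, p)`, (C1_η),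
(C2_η-GZ) or (C3_η) of any pair is claimed or moved; no named Literature fact is introduced (Rohrlich's
theorem is the tree's PROVED `Rohrlich1984_nonvanishing_twists_holds`); axioms standard.

## What and why

With existence (`QuadraticBranch{Minus,Plus}LFunctionExistence.lean`) and uniqueness up to `ℤ_p^×`
(x1b, `QuadraticBranch{Minus,Plus}LFunctionUnique.lean`) the branch functions are objects of the tree;
this file adds that they are NON-ZERO, so that `Ideal.span {Lη} ≠ 0` in (C1_η)'s
`DF.charIdeal = D.charIdeal · (Lη)` (consistency of the typed conjecture with `DF.X` torsion) and in
the `η`-reading of Kobayashi Thm. 7.4 (cancellation of `(L_p⁺(V, η, X))`). Argument (the tree's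
trivial-branch `ne_zero_of_isCongrModOmega_odd/even`, Pollack Cor. 5.11, run on the branch): if
`L = 0`, the interpolation property kills every branch Birch sum `∑_a ψ(a)[a/p^{n+1}]^δ_f` at the
characters `ψ` of order `2pⁿ` (`n` of one parity); such `ψ` exist over `ℚ̄` at every level
(`exists_dirichletCharacter_quadraticBranch`: the quadratic character mod `p` times a primitive character
of `Γ`, primitive by a conductor count, of order `2pⁿ` in `ℂ_p` by `orderOf_apply_cyclotomicGenerator`,
of parity `(−1)^{⌊p/2⌋}`); by Birch's formula in `ℂ` (plus symbols for `p ≡ 1 (mod 4)`, minus symbols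
for `p ≡ 3 (mod 4)` — both tree theorems) `L(f, ψ̄, 1) = 0` for infinitely many primitive `ψ` of
`p`-power conductor, contradicting Rohrlich.

References: [Kobayashi2003] Thm. 3.2 (p. 7); [Pollack2003] Cor. 5.11; [RohrlichInventiones1984] Theorem
(p. 409); [MazurTateTeitelbaum1986Invent] §I.8 (8.6), §I.13; [Washington1997] §7.2.
-/

noncomputable section

open scoped Classical MatrixGroups ModularForm

open CongruenceSubgroup Polynomial Literature.NumberTheory.EllipticCurves
  Literature.NumberTheory.EllipticCurves.ModularForms

namespace Summit.BirchSwinnertonDyer.Rank1Residual.Additive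

/-! ## §11 Non-vanishing: `L_p^∓(V, η, X) ≠ 0` (Rohrlich) -/

section NonVanishing

variable {p : ℕ} [hp : Fact p.Prime]

/-- The quadratic character mod `p` with values in a field of characteristic `0` has order `2`
(`p` odd). [folklore] -/
theorem orderOf_quadraticChar_ringHomComp_of_charZero (K : Type*) [Field K] [CharZero K]
    (hp2 : p ≠ 2) : orderOf ((quadraticChar (ZMod p)).ringHomComp (Int.castRingHom K)) = 2 := by
  set chiQ : MulChar (ZMod p) K := (quadraticChar (ZMod p)).ringHomComp (Int.castRingHom K)
  have hq : chiQ.IsQuadratic := (quadraticChar_isQuadratic (ZMod p)).comp _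
  refine orderOf_eq_prime hq.sq_eq_one fun h1 ↦ ?_
  have hchar : ringChar (ZMod p) ≠ 2 := by rwa [ZMod.ringChar_zmod_n]
  obtain ⟨a, ha⟩ := quadraticChar_exists_neg_one hchar
  have h := congrArg (fun χ : MulChar (ZMod p) K ↦ χ a) h1
  simp only [chiQ, MulChar.ringHomComp_apply, ha, map_neg, map_one] at h
  have ha0 : a ≠ 0 := by
    rintro rfl
    rw [quadraticChar_zero] at ha
    exact absurd ha (by norm_num)
  rw [MulChar.one_apply (Ne.isUnit ha0)] at h
  exact absurd h (by norm_num)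

/-- **Primitivity**: for `n ≥ 1`, `χ'` primitive modulo `p^{n+1}` and `etaL` the lift of a character
modulo `p`, the product `etaL χ'` is primitive modulo `p^{n+1}` (`cond(χ') ∣ lcm(cond(etaL⁻¹), cond(etaLχ'))`,
`cond(etaL) ∣ p`). [folklore] -/
theorem isPrimitive_changeLevel_mul {K : Type*} [Field K] {n : ℕ} (hn : 1 ≤ n)
    (q : DirichletCharacter K p) (χ' : DirichletCharacter K (p ^ (n + 1))) (hχ' : χ'.IsPrimitive) :
    (DirichletCharacter.changeLevel (dvd_pow_self p (by omega) : p ∣ p ^ (n + 1)) q * χ').IsPrimitive := by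
  have hP : p.Prime := hp.out
  haveI : NeZero (p ^ (n + 1)) := ⟨pow_ne_zero _ hP.ne_zero⟩
  haveI : NeZero p := ⟨hP.ne_zero⟩
  set etaL := DirichletCharacter.changeLevel (dvd_pow_self p (by omega) : p ∣ p ^ (n + 1)) q with hη
  set ψ := etaL * χ' with hψ
  -- `χ' = etaL⁻¹ ψ`, so `p^{n+1} = cond χ' ∣ lcm (cond etaL⁻¹) (cond ψ)`
  have h1 : χ' = etaL⁻¹ * ψ := by rw [hψ, inv_mul_cancel_left]
  have hcond := DirichletCharacter.conductor_mul_dvd_lcm_conductor etaL⁻¹ ψ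
  rw [← h1, hχ', DirichletCharacter.conductor_inv] at hcond
  have hetaL : etaL.conductor ∣ p := by
    rw [hη, DirichletCharacter.conductor_changeLevel]
    exact DirichletCharacter.conductor_dvd_level q
  obtain ⟨j, hj, hjc⟩ := (Nat.dvd_prime_pow hP).mp (DirichletCharacter.conductor_dvd_level ψ)
  -- `lcm (cond etaL) (cond ψ) ∣ p^{max 1 j}`
  have hlcm : Nat.lcm etaL.conductor ψ.conductor ∣ p ^ max 1 j :=
    Nat.lcm_dvd (hetaL.trans (by simpa only [pow_one] using pow_dvd_pow p (le_max_left 1 j)))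
      (hjc ▸ pow_dvd_pow p (le_max_right 1 j))
  have h2 := (Nat.pow_dvd_pow_iff_le_right hP.one_lt).mp (hcond.trans hlcm)
  have hjn : j = n + 1 := by
    rcases le_or_gt j 1 with h | h
    · rw [max_eq_left h] at h2; omega
    · rw [max_eq_right h.le] at h2; omega
  rw [DirichletCharacter.isPrimitive_def, hjc, hjn]

variable {N : ℕ} [NeZero N] (f : CuspForm (Gamma0 N) 2)

omit [NeZero N] in
/-- The minus twisted symbol sum is compatible with ring homomorphisms of the coefficient field.
[folklore] -/
theorem ratMinusTwistedSymbolSum_ringHomComp {K L : Type*} [Field K] [Field L] (g : K →+* L)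
    {m : ℕ} [NeZero m] (χ : DirichletCharacter K m) :
    ratMinusTwistedSymbolSum f (χ.ringHomComp g) = g (ratMinusTwistedSymbolSum f χ) := by
  simp only [ratMinusTwistedSymbolSum, map_sum, map_mul, map_ratCast, MulChar.ringHomComp_apply]

/-- **Over `ℂ_p`: a product `etaL χ'` with `χ'` primitive, even, of `p`-power order modulo `p^{n+1}`
has order exactly `2pⁿ`** (`p` odd; `ord χ'(γ) = pⁿ` by `orderOf_apply_cyclotomicGenerator`, so
`ord χ' = pⁿ`; `ord etaL = 2` is coprime). [folklore] -/
theorem orderOf_changeLevel_mul_eq (hp2 : p ≠ 2) {n : ℕ} (hn : 1 ≤ n)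
    (χ' : DirichletCharacter ℂ_[p] (p ^ (n + 1))) (hprim : χ'.IsPrimitive) (hev : χ'.Even)
    (hord : ∃ j : ℕ, orderOf χ' = p ^ j) :
    orderOf (DirichletCharacter.changeLevel (dvd_pow_self p (by omega) : p ∣ p ^ (n + 1))
      ((quadraticChar (ZMod p)).ringHomComp (Int.castRingHom ℂ_[p])) * χ') = 2 * p ^ n := by
  have hP : p.Prime := hp.out
  have he : cyclotomicExponent p = 1 := if_neg hp2
  haveI : NeZero (p ^ (n + 1)) := ⟨pow_ne_zero _ hP.ne_zero⟩
  obtain ⟨j, hj⟩ := hord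
  -- `orderOf χ'(γ) = pⁿ`
  have hγ : orderOf (χ' (cyclotomicGenerator p : ZMod (p ^ (n + 1)))) = p ^ n := by
    have h := orderOf_apply_cyclotomicGenerator (m := n + 1) (by rw [he]; omega) χ' hprim hev ⟨j, hj⟩
    rwa [he, Nat.add_sub_cancel] at h
  -- hence `orderOf χ' = pⁿ`
  have hge : n ≤ j := by
    have h1 : χ' (cyclotomicGenerator p : ZMod (p ^ (n + 1))) ^ p ^ j = 1 := by
      rw [← MulChar.pow_apply' χ' (pow_ne_zero _ hP.ne_zero), ← hj, pow_orderOf_eq_one,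
        MulChar.one_apply (isUnit_cyclotomicGenerator_cast p _)]
    have h2 : p ^ n ∣ p ^ j := by rw [← hγ]; exact orderOf_dvd_of_pow_eq_one h1
    exact (Nat.pow_dvd_pow_iff_le_right hP.one_lt).mp h2
  have hle : j ≤ n := by
    have h1 : orderOf χ' ∣ Fintype.card (ZMod (p ^ (n + 1)))ˣ :=
      orderOf_dvd_of_pow_eq_one (mulChar_pow_card_units_eq_one χ')
    rw [hj, ZMod.card_units_eq_totient, Nat.totient_prime_pow hP (by omega), Nat.add_sub_cancel] at h1
    have hcop : Nat.Coprime (p ^ j) (p - 1) :=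
      Nat.Coprime.pow_left _ ((Nat.coprime_self_sub_right hP.one_le).mpr (Nat.coprime_one_right p))
    exact (Nat.pow_dvd_pow_iff_le_right hP.one_lt).mp (hcop.dvd_of_dvd_mul_right h1)
  have hordχ' : orderOf χ' = p ^ n := by rw [hj, le_antisymm hle hge]
  have hordq : orderOf (DirichletCharacter.changeLevel (dvd_pow_self p (by omega) : p ∣ p ^ (n + 1))
      ((quadraticChar (ZMod p)).ringHomComp (Int.castRingHom ℂ_[p]))) = 2 := by
    rw [orderOf_injective (DirichletCharacter.changeLevel _)
      (DirichletCharacter.changeLevel_injective _) _, orderOf_quadraticChar_ringHomComp_of_charZero ℂ_[p] hp2]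
  have hcop : Nat.Coprime 2 (p ^ n) := Nat.Coprime.pow_right _ (Nat.coprime_two_left.mpr (hP.odd_of_ne_two hp2))
  rw [(Commute.all _ χ').orderOf_mul_eq_mul_orderOf_of_coprime (by rwa [hordq, hordχ']), hordq, hordχ']

/-- **Characters of order `2pⁿ` over `ℚ̄` at every level `p^{k+3}`**, with controlled parity and
primitivity: for `p` odd and `K = ℚ̄` (any algebraically closed field of characteristic `0`), there is
`ψ` modulo `p^{k+3}`, primitive, with `ψ(−1) = (−1)^{⌊p/2⌋}` and whose image in `ℂ_p` has order
`2p^{k+2}` — the product of the quadratic character mod `p` and a primitive character of `Γ`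
(`exists_isPrimitive_even_orderOf_eq_prime_pow`). [folklore] -/
theorem exists_dirichletCharacter_quadraticBranch (hp2 : p ≠ 2) (K : Type*) [Field K] [CharZero K]
    [IsAlgClosed K] (τ : K →+* ℂ_[p]) (k : ℕ) :
    ∃ ψ : DirichletCharacter K (p ^ (k + 3)), ψ.IsPrimitive ∧
      ψ (-1) = ((-1 : ℤ) ^ (p / 2) : K) ∧ orderOf (ψ.ringHomComp τ) = 2 * p ^ (k + 2) := by
  classical
  have hP : p.Prime := hp.out
  haveI : NeZero (p ^ (k + 3)) := ⟨pow_ne_zero _ hP.ne_zero⟩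
  haveI : NeZero ((Nat.totient (p ^ (k + 3)) : ℕ) : K) :=
    ⟨Nat.cast_ne_zero.mpr (Nat.totient_pos.mpr (pow_pos hP.pos _)).ne'⟩
  obtain ⟨χ', hprim, hev, hord⟩ := exists_isPrimitive_even_orderOf_eq_prime_pow K (p := p) k
  have hdvd : p ∣ p ^ (k + 2 + 1) := dvd_pow_self p (by omega)
  set qK : DirichletCharacter K p := (quadraticChar (ZMod p)).ringHomComp (Int.castRingHom K) with hqK
  set etaL : DirichletCharacter K (p ^ (k + 2 + 1)) := DirichletCharacter.changeLevel hdvd qK with hη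
  refine ⟨etaL * χ', isPrimitive_changeLevel_mul (by omega) qK χ' hprim, ?_, ?_⟩
  · -- parity: `ψ(−1) = q(−1) · 1 = χ₄(p) = (−1)^{⌊p/2⌋}`
    have hcop : IsCoprime (-1 : ℤ) ((p ^ (k + 2 + 1) : ℕ) : ℤ) := (isCoprime_one_left).neg_left
    have h1 : etaL (-1) = qK (-1) := by
      have h := DirichletCharacter.changeLevel_eq_cast_of_dvd' qK hdvd hcop
      push_cast at h
      rw [hη, h]
    rw [MulChar.mul_apply, h1, show χ' (-1) = 1 from hev, mul_one, hqK, MulChar.ringHomComp_apply]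
    have hchar : ringChar (ZMod p) ≠ 2 := by rwa [ZMod.ringChar_zmod_n]
    rw [quadraticChar_neg_one hchar, ZMod.card, ZMod.χ₄_eq_neg_one_pow (Nat.odd_iff.mp (hP.odd_of_ne_two hp2))]
    simp
  · -- order over `ℂ_p`
    rw [MulChar.ringHomComp_mul]
    have hη' : etaL.ringHomComp τ = DirichletCharacter.changeLevel hdvd
        ((quadraticChar (ZMod p)).ringHomComp (Int.castRingHom ℂ_[p])) := by
      rw [hη, hqK]
      ext a
      simp only [MulChar.ringHomComp_apply, DirichletCharacter.changeLevel_eq_cast_of_dvd,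
        map_intCast, eq_intCast]
    rw [hη']
    exact orderOf_changeLevel_mul_eq hp2 (by omega) (χ'.ringHomComp τ)
      ((isPrimitive_ringHomComp_iff τ χ').mpr hprim) ((even_ringHomComp_iff τ χ').mpr hev)
      (by rw [orderOf_ringHomComp]; exact hord)

variable {f} {V : WeierstrassCurve ℚ} [V.IsElliptic] [V.IsGloballyMinimal]

/-- **Rohrlich forbids the vanishing of all branch Birch sums along a parity class of levels**: if
for some `a` every Dirichlet character `ψ` mod `p^{2i+a+3}` (`i ≥ 0`, values in `ℂ_p`) of ORDER
`2p^{2i+a+2}` has `∑_b ψ(b)[b/p^{2i+a+3}]^δ_f = 0` (`δ` the parity of `η`), contradiction: Birch's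
formula (plus for `p ≡ 1 (mod 4)`, minus for `p ≡ 3 (mod 4)`) gives `L(f, ψ̄, 1) = 0` for infinitely
many primitive `ψ` of `p`-power conductor, against `Rohrlich1984_nonvanishing_twists_holds`. Branch twin
of the tree's (private) `false_of_forall_ratTwistedSymbolSum_eq_zero`.
[cite: RohrlichInventiones1984, Theorem (p. 409)] [cite: MazurTateTeitelbaum1986Invent, §I.8 (8.6)] -/
theorem false_of_forall_branchSymbolSum_eq_zero (hp2 : p ≠ 2) (hf : IsNewformOf V f)
    (hgood : V.HasGoodReductionAtPrime p) (a : ℕ)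
    (hvan : ∀ (i : ℕ) (ψ : DirichletCharacter ℂ_[p] (p ^ (2 * i + a + 3))),
      orderOf ψ = 2 * p ^ (2 * i + a + 2) →
        (if Even (p / 2) then ratTwistedSymbolSum f ψ else ratMinusTwistedSymbolSum f ψ) = 0) :
    False := by
  classical
  have hP : p.Prime := hp.out
  have hQ : coeffField f = ⊥ := hf.coeffField_eq_bot
  have hpN : ¬ p ∣ N := not_dvd_level_of_isNewformOf hf hgood
  have hR := Rohrlich1984_nonvanishing_twists_holds.primePow hf.1 hpN
  have hB : ratTwistedSymbolSum_mul_plusPeriod (f := f) :=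
    ratTwistedSymbolSum_mul_plusPeriod_of_lattice isZLattice_periodLattice_holds
      (exists_nsmul_modularSymbol_mem_periodLattice_of_isNewformOf hf)
  let σ : AlgebraicClosure ℚ →+* ℂ := (@IsAlgClosed.lift ℂ _ _ ℚ _ _ (AlgebraicClosure ℚ) _ _
    (AlgebraicClosure.instAlgebra ℚ) _ _ _ (AlgebraicClosure.isAlgebraic ℚ)).toRingHom
  let τ : AlgebraicClosure ℚ →+* ℂ_[p] := (@IsAlgClosed.lift ℂ_[p] _ _ ℚ _ _ (AlgebraicClosure ℚ) _ _
    (AlgebraicClosure.instAlgebra ℚ) _ _ _ (AlgebraicClosure.isAlgebraic ℚ)).toRingHom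
  have hψ : ∀ i : ℕ, ∃ ψ : DirichletCharacter (AlgebraicClosure ℚ) (p ^ (2 * i + a + 3)),
      ψ.IsPrimitive ∧ ψ (-1) = ((-1 : ℤ) ^ (p / 2) : AlgebraicClosure ℚ) ∧
        orderOf (ψ.ringHomComp τ) = 2 * p ^ (2 * i + a + 2) :=
    fun i ↦ exists_dirichletCharacter_quadraticBranch hp2 (AlgebraicClosure ℚ) τ (2 * i + a)
  choose ψ hψprim hψpar hψord using hψ
  -- parity of `ψ_i σ` in `ℂ`
  have hsgn : ∀ i, (ψ i).ringHomComp σ (-1) = ((-1 : ℤ) ^ (p / 2) : ℂ) := by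
    intro i
    rw [MulChar.ringHomComp_apply, hψpar]
    simp
  -- over `ℂ`, `L(f, (σψ_i)⁻¹, 1) = 0` for every `i`
  have hbad : ∀ i : ℕ, (⟨p ^ (2 * i + a + 3), ((ψ i).ringHomComp σ)⁻¹⟩ :
      Σ m : ℕ, DirichletCharacter ℂ m) ∈
      {χ : Σ m : ℕ, DirichletCharacter ℂ m |
        χ.1 ≠ 0 ∧ χ.1.primeFactors ⊆ {p} ∧ χ.2.IsPrimitive ∧
          ∃ L : ℂ → ℂ, Differentiable ℂ L ∧
            (∀ s : ℂ, 2 < s.re → L s = twistedLSeries f χ.2 s) ∧ L 1 = 0} := by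
    intro i
    haveI : NeZero (p ^ (2 * i + a + 3)) := ⟨pow_ne_zero _ hP.ne_zero⟩
    have hprimC : DirichletCharacter.IsPrimitive ((ψ i).ringHomComp σ) :=
      (isPrimitive_ringHomComp_iff σ (ψ i)).mpr (hψprim i)
    refine ⟨pow_ne_zero _ hP.ne_zero, (Nat.primeFactors_prime_pow (by omega) hP).le, ?_, ?_⟩
    · rw [DirichletCharacter.isPrimitive_def, DirichletCharacter.conductor_inv]
      exact hprimC
    obtain ⟨L, hLd, hL⟩ := exists_differentiable_eq_twistedLSeries_holds f ((ψ i).ringHomComp σ)⁻¹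
    refine ⟨L, hLd, hL, ?_⟩
    -- the branch Birch sum of `ψ_i` vanishes in `K`, hence in `ℂ`
    have hzeroK : (if Even (p / 2) then ratTwistedSymbolSum f (ψ i)
        else ratMinusTwistedSymbolSum f (ψ i)) = 0 := by
      have hτ := hvan i ((ψ i).ringHomComp τ) (hψord i)
      split_ifs at hτ ⊢ with hev
      · rwa [ratTwistedSymbolSum_ringHomComp, map_eq_zero] at hτ
      · rwa [ratMinusTwistedSymbolSum_ringHomComp, map_eq_zero] at hτ
    by_cases hev : Even (p / 2)
    · -- `p ≡ 1 (mod 4)`: `ψ` even, Birch for `[·]⁺`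
      have heven : DirichletCharacter.Even ((ψ i).ringHomComp σ) := by
        change (ψ i).ringHomComp σ (-1) = 1
        rw [hsgn]; push_cast; exact Even.neg_one_pow hev
      have hBirch := hB hf.1 hQ hprimC heven hLd hL
      rw [if_pos hev] at hzeroK
      rw [ratTwistedSymbolSum_ringHomComp, hzeroK, map_zero, zero_mul, eq_comm, mul_eq_zero] at hBirch
      exact hBirch.resolve_left (gaussSum_stdAddChar_ne_zero hprimC)
    · -- `p ≡ 3 (mod 4)`: `ψ` odd, Birch for `[·]⁻`
      have hodd : DirichletCharacter.Odd ((ψ i).ringHomComp σ) := by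
        change (ψ i).ringHomComp σ (-1) = -1
        rw [hsgn]; push_cast; exact Odd.neg_one_pow (Nat.not_even_iff_odd.mp hev)
      have hBirch := ratMinusTwistedSymbolSum_mul_minusPeriod_mul_I f hf.1 hQ hprimC hodd hLd hL
      rw [if_neg hev] at hzeroK
      rw [ratMinusTwistedSymbolSum_ringHomComp, hzeroK, map_zero, zero_mul, zero_mul, eq_comm,
        mul_eq_zero] at hBirch
      exact hBirch.resolve_left (gaussSum_stdAddChar_ne_zero hprimC)
  -- infinitely many distinct characters, contradicting Rohrlich
  let F : ℕ → Σ m : ℕ, DirichletCharacter ℂ m := fun i ↦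
    ⟨p ^ (2 * i + a + 3), ((ψ i).ringHomComp σ)⁻¹⟩
  have hFinj : Function.Injective F := fun i l h ↦ by
    have h1 : p ^ (2 * i + a + 3) = p ^ (2 * l + a + 3) := congr_arg Sigma.fst h
    have := Nat.pow_right_injective hP.two_le h1
    omega
  have hfin : (Set.univ : Set ℕ).Finite := by
    refine (hR.preimage hFinj.injOn).subset fun i _ ↦ ?_
    exact hbad i
  exact Set.infinite_univ hfin

/-- **`L_p⁻(V, η, X) ≠ 0`**: every `L` with Kobayashi's quadratic-branch minus interpolation property
(`IsQuadraticBranchMinusLFunction f p ϖ L`, `ϖ ≠ 0`) is non-zero — otherwise all branch Birch sums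
at the characters of order `2pⁿ`, `n` odd, vanish, against Rohrlich. [cite: Kobayashi2003, Thm. 3.2 (p. 7)]
[cite: RohrlichInventiones1984, Theorem (p. 409)] [cite: Pollack2003, Cor. 5.11] -/
theorem IsQuadraticBranchMinusLFunction.ne_zero_of_isNewformOf (hp2 : p ≠ 2) (hf : IsNewformOf V f)
    (hgood : V.HasGoodReductionAtPrime p) {ϖ : ℚ} (hϖ : ϖ ≠ 0) {L : IwasawaAlgebra p}
    (hL : IsQuadraticBranchMinusLFunction f p ϖ L) : L ≠ 0 := by
  rintro rfl
  have hP : p.Prime := hp.out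
  have he : cyclotomicExponent p = 1 := if_neg hp2
  obtain ⟨-, u, hu⟩ := hL
  refine false_of_forall_branchSymbolSum_eq_zero hp2 hf hgood 1 fun i ψ hψ ↦ ?_
  -- level `p^{2i+4} = p^{n+1}` with `n = 2i+3` odd
  have key : ∀ (n : ℕ) (hn : Odd n) (K : ℕ) (hK : K = n + 1) (ψ : DirichletCharacter ℂ_[p] (p ^ K)),
      orderOf ψ = 2 * p ^ n →
      (if Even (p / 2) then ratTwistedSymbolSum f ψ else ratMinusTwistedSymbolSum f ψ) = 0 := by
    intro n hn K hK ψ hψ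
    subst hK
    have h := hu n hn ψ hψ
    simp only [map_zero, zero_mul] at h
    have h0 := h.unique (hasSum_zero)
    -- the prefactors are non-zero
    have hordζ : orderOf (ψ (cyclotomicGenerator p : ZMod (p ^ (n + 1)))) = p ^ n := by
      have := fun (K : ℕ) (hK : K = n + cyclotomicExponent p) (ψ : DirichletCharacter ℂ_[p] (p ^ K))
        (hψ : orderOf ψ = 2 * p ^ n) ↦ show orderOf (ψ (cyclotomicGenerator p : ZMod (p ^ K))) = p ^ n by
          subst hK; exact orderOf_apply_cyclotomicGenerator_of_orderOf_eq hp2 ψ hψ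
      exact this (n + 1) (by rw [he]) ψ hψ
    have hprim : IsPrimitiveRoot (ψ (cyclotomicGenerator p : ZMod (p ^ (n + 1)))) (p ^ n) :=
      hordζ ▸ IsPrimitiveRoot.orderOf _
    have hω := eval₂_cyclotomicOmegaPlus_ne_zero hn hprim
    have hc : ((-1 : ℂ_[p]) ^ ((n + 1) / 2) *
        algebraMap ℚ_[p] ℂ_[p] ((((u : ℤ_[p]ˣ) : ℤ_[p]) : ℚ_[p]) * (ϖ : ℚ_[p]))) ≠ 0 := by
      refine mul_ne_zero (pow_ne_zero _ (neg_ne_zero.mpr one_ne_zero)) ?_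
      rw [map_ne_zero_iff _ (algebraMap ℚ_[p] ℂ_[p]).injective]
      refine mul_ne_zero (fun h ↦ Units.ne_zero u ?_) (by exact_mod_cast hϖ)
      exact IsFractionRing.injective ℤ_[p] ℚ_[p] (by rw [map_zero]; exact h)
    rw [div_eq_zero_iff, or_iff_left hω, mul_eq_zero, or_iff_right hc] at h0
    exact h0
  exact key (2 * i + 3) ⟨i + 1, by ring⟩ (2 * i + 1 + 3) (by ring) ψ (by
    rw [show 2 * i + 1 + 2 = 2 * i + 3 by ring] at hψ; exact hψ)

/-- **`L_p⁺(V, η, X) ≠ 0`**: every `L` with Kobayashi's quadratic-branch PLUS interpolation property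
(`IsQuadraticBranchPlusLFunction f p ϖ L`, `ϖ ≠ 0`) is non-zero (the characters of order `2pⁿ`, `n ≥ 2`
even, and Rohrlich). In particular the `Lη` of (C1_η) generate NON-ZERO ideals.
[cite: Kobayashi2003, Thm. 3.2 (p. 7)] [cite: RohrlichInventiones1984, Theorem (p. 409)] [cite: Pollack2003, Cor. 5.11] -/
theorem IsQuadraticBranchPlusLFunction.ne_zero_of_isNewformOf (hp2 : p ≠ 2) (hf : IsNewformOf V f)
    (hgood : V.HasGoodReductionAtPrime p) {ϖ : ℚ} (hϖ : ϖ ≠ 0) {L : IwasawaAlgebra p}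
    (hL : IsQuadraticBranchPlusLFunction f p ϖ L) : L ≠ 0 := by
  rintro rfl
  have hP : p.Prime := hp.out
  have he : cyclotomicExponent p = 1 := if_neg hp2
  obtain ⟨u, hu⟩ := hL
  refine false_of_forall_branchSymbolSum_eq_zero hp2 hf hgood 0 fun i ψ hψ ↦ ?_
  have key : ∀ (n : ℕ) (hn : Even n) (hn1 : 1 ≤ n) (K : ℕ) (hK : K = n + 1)
      (ψ : DirichletCharacter ℂ_[p] (p ^ K)), orderOf ψ = 2 * p ^ n →
      (if Even (p / 2) then ratTwistedSymbolSum f ψ else ratMinusTwistedSymbolSum f ψ) = 0 := by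
    intro n hn hn1 K hK ψ hψ
    subst hK
    have h := hu n hn ψ hψ
    simp only [map_zero, zero_mul] at h
    have h0 := h.unique (hasSum_zero)
    have hordζ : orderOf (ψ (cyclotomicGenerator p : ZMod (p ^ (n + 1)))) = p ^ n := by
      have := fun (K : ℕ) (hK : K = n + cyclotomicExponent p) (ψ : DirichletCharacter ℂ_[p] (p ^ K))
        (hψ : orderOf ψ = 2 * p ^ n) ↦ show orderOf (ψ (cyclotomicGenerator p : ZMod (p ^ K))) = p ^ n by
          subst hK; exact orderOf_apply_cyclotomicGenerator_of_orderOf_eq hp2 ψ hψ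
      exact this (n + 1) (by rw [he]) ψ hψ
    have hprim : IsPrimitiveRoot (ψ (cyclotomicGenerator p : ZMod (p ^ (n + 1)))) (p ^ n) :=
      hordζ ▸ IsPrimitiveRoot.orderOf _
    have hω := eval₂_cyclotomicOmegaMinus_ne_zero hn hprim
    have hc : ((-1 : ℂ_[p]) ^ (n / 2 + 1) *
        algebraMap ℚ_[p] ℂ_[p] ((((u : ℤ_[p]ˣ) : ℤ_[p]) : ℚ_[p]) * (ϖ : ℚ_[p]))) ≠ 0 := by
      refine mul_ne_zero (pow_ne_zero _ (neg_ne_zero.mpr one_ne_zero)) ?_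
      rw [map_ne_zero_iff _ (algebraMap ℚ_[p] ℂ_[p]).injective]
      refine mul_ne_zero (fun h ↦ Units.ne_zero u ?_) (by exact_mod_cast hϖ)
      exact IsFractionRing.injective ℤ_[p] ℚ_[p] (by rw [map_zero]; exact h)
    rw [div_eq_zero_iff, or_iff_left hω, mul_eq_zero, or_iff_right hc] at h0
    exact h0
  exact key (2 * i + 2) ⟨i + 1, by ring⟩ (by omega) (2 * i + 0 + 3) (by ring) ψ (by
    rw [show 2 * i + 0 + 2 = 2 * i + 2 by ring] at hψ; exact hψ)

end NonVanishing

end Summit.BirchSwinnertonDyer.Rank1Residual.Additive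

end
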